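import Summits.BirchSwinnertonDyer.BirchSwinnertonDyer.Theorems.KolyvaginRankRigidityAtTwoOppositeSignReciprocityAtTwo
import Summits.BirchSwinnertonDyer.BirchSwinnertonDyer.Theorems.KolyvaginRankRigidityAtTwoSignedRefillSupplyAtTwo
import Summits.BirchSwinnertonDyer.BirchSwinnertonDyer.Theorems.KolyvaginRankRigidityAtTwoChebotarevWindowPrimeAtTwo
import Summits.BirchSwinnertonDyer.BirchSwinnertonDyer.Theorems.Rank1ResidualJetCompatibleData
import Summits.BirchSwinnertonDyer.Rank1Residual.X11b.KolyvaginHpointsAssembly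
import Literature.NumberTheory.EllipticCurves.HeegnerPointsOfConductorRationalityProofs
import HarnessLib

/-!
# Crux U1 `KolyvaginBoundedDefectAtTwo` (stmt-BirchSwinnertonDyer-28083), LINE 17 `kolyvagin_swap` —
# Zζ · THE LONE SEED PRIME HAS A PARTNER (`LoneSeedPartnerAtTwo`, pen v7.5–v7.8, the critic's finding #298 (ζ) read as a lemma)
# — a tree theorem MODULO ONE NAMED PRINT FACT (Gross 1991 Prop. 3.7 (2) = the registered print stub P372)

Width seat `bsd-line-krr2-p2` g18 (ONE READER on LINE 17); `--supports stmt-BirchSwinnertonDyer-28083` (helper). The proof is the pen's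
kernel derivation `loneSeedPartnerAtTwo_of : OSR → SRS → LoneSeedPartnerAtTwo` (v7.7 `kolyvagin_swap_v77.lean` 55dfebd9 l.669–737,
planner `bsd-idea-1` g15) fed with the two tree theorems OSR `KolyvaginLowerBoundAtTwo.oppositeSignReciprocityAtTwo_of_frobeniusCongruence`
(pen g15, landed in three parts by this seat; conditional on P372) and SRS `RegularWalk.signedRefillSupplyAtTwo` (this seat, p723829,
unconditional). HONEST FRAMING: CONDITIONAL on `prop37_2_frobeniusCongruence`; Zζ is a SUPPORT lemma of the (unregistered) v7.5+
typing of LINE 17 — the corner `t = 0 ∧ #s = 1` of the shaped shed is vacuous; nothing here proves SWα, U1, a rung or BSD. BSD is NOT proved.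

## Statement
`loneSeedPartnerAtTwo_of_frobeniusCongruence (h37) : <LoneSeedPartnerAtTwo>` — the pen's Prop (v7.7 l.511–522 = v7.8) BYTE-FOR-BYTE
with its one defined term `OppShape W K ι τ M e u a 0` UNFOLDED (the v7.x definitions are not an importable module; with `OppShape` in
scope the skeleton's statement is this one by definitional unfolding): on U1's habitat, for `τ ≠ 1` and `u = ±1` there is `κ₀ : ℕ → ℕ`
(here `κ₀ a = a + C_osr + C_srs + 6`) such that a seed part `s ≠ 1` with `#s ≤ 1`, an engine part `e` of index `≥ I ≥ M+1` regular at
`2^M`, margin one, shape `Sh(0, a)` of the `(−u)`-part of `H_{𝓕(e)}`, an exact `u`-class `c_M(se)` VISIBLE beyond `2^(κ₀ a)` — is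
IMPOSSIBLE.

## Proof (the pen's, verbatim up to the two suppliers)
The class is non-zero beyond `2^(κ₀ a)`, so `M > a + C_srs + 3`; `s` is a single prime; SRS supplies an exact `(−u)`-partner
`z ∈ H_{𝓕(se)}` of order `≥ 2^{M−a−C_srs}`; the pair Čebotarev `exists_kolyvaginPrime_notMem_pair_of_heegner` supplies a Kolyvagin
`ℓ ∤ se` of index `≥ M+1` with a place keeping both global orders up to two bits; Gross's CM facts (`exists_compatible_data_of_grossCM`)
give a compatible datum at `seℓ`; OSR with `m := n = se` returns a prime factor of `n/n = 1` — there is none.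
References (locators only; no cited FACT is declared): [cite: Kolyvagin1991StructureSha, Prop. 8] [cite: MazurRubin2004, §4.1]
[cite: GrossLMS1991, §9, Prop. 3.7 (2)] [cite: McCallumLMS1991, §5].
Design: no definitions; `K : Type`; axioms `propext`, `Classical.choice`, `Quot.sound`.
-/

set_option autoImplicit false
-- the Theorems namespace of this sub repeats the summit name by design (D-0017 nested layout)
set_option linter.dupNamespace false

noncomputable section

open scoped Classical
open Function NumberField IsDedekindDomain WeierstrassCurve Field Finset
open Literature.NumberTheory.EllipticCurves Literature.NumberTheory.EllipticCurves.Jetchev2008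
open Literature.NumberTheory.EllipticCurves.KolyvaginPairing
open Literature.NumberTheory.GaloisRepresentations Literature.NumberTheory.GaloisCohomology
open Literature.NumberTheory.Automorphic Literature.NumberTheory
open Literature.NumberTheory.EllipticCurves.GrossLMS1991 (prop37_2_frobeniusCongruence)
open Summit.BirchSwinnertonDyer.Rank1Residual
open Summit.BirchSwinnertonDyer.Rank1Residual.JET.SelmerVocabulary
open Rat.HeightOneSpectrum

namespace Summit.BirchSwinnertonDyer.BirchSwinnertonDyer.Theorems.KolyvaginAtTwo.RegularWalk

set_option maxHeartbeats 800000 in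
/-- **Zζ `LoneSeedPartnerAtTwo` (pen v7.5–v7.8, VERBATIM with `OppShape … 0` unfolded) from Gross 1991 Prop. 3.7 (2).** The lone seed
prime `s` (a prime: square-free, `#s ≤ 1`, `s ≠ 1`) and the engine part `e` with shape `Sh(0,a)`: if `c_M(se)` were visible beyond
`2^(κ₀ a)`, `κ₀ a := a + C_osr + C_srs + 6`, then OSR (with the SRS partner, a deep pair-Čebotarev prime and a compatible datum) would
produce a prime factor of `se/se = 1`. CONDITIONAL on `h37` (through OSR only). [cite: Kolyvagin1991StructureSha, Prop. 8]
[cite: MazurRubin2004, §4.1] [cite: GrossLMS1991, §9] -/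
theorem loneSeedPartnerAtTwo_of_frobeniusCongruence (h37 : prop37_2_frobeniusCongruence) :
  ∀ (W : WeierstrassCurve ℚ) [W.IsElliptic] [W.IsGloballyMinimal], ¬ W.HasCM → (Literature.NumberTheory.EllipticCurves.Rank1Residual.GoodOrd W 2 ∨ Literature.NumberTheory.EllipticCurves.Rank1Residual.Mult W 2) → (∀ m : ℕ, W.HasSurjectiveModNGaloisRep (2 ^ m : ℕ)) → ∀ (K : Type) [Field K] [NumberField K], Literature.NumberTheory.EllipticCurves.IsImaginaryQuadratic K → ∀ [NeZero (W.conductorNorm ℤ)], Literature.NumberTheory.EllipticCurves.SatisfiesHeegnerHypothesis (W.conductorNorm ℤ) K → Odd (NumberField.discr K) → NumberField.discr K ≠ -3 → AddSubgroup.torsionBy (W.baseChange K).toAffine.Point (2 : ℤ) = ⊥ → Literature.NumberTheory.EllipticCurves.SatisfiesHeegnerHypothesis 2 K → ∀ (Dt : Literature.NumberTheory.EllipticCurves.ModularForms.ModularParametrizationData W (W.conductorNorm ℤ)) (β : ℤ) (ι : K →+* ℂ) [∀ k : ℕ, NumberField (ringClassField K ι k)], (4 * (W.conductorNorm ℤ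 : ℤ)) ∣ β ^ 2 - NumberField.discr K →
    ∀ (τ : K ≃ₐ[ℚ] K), τ ≠ 1 → ∀ (u : ℤ), (u = 1 ∨ u = -1) →
    ∃ κ₀ : ℕ → ℕ, ∀ (a I M s e : ℕ) (d : Literature.NumberTheory.EllipticCurves.KolyvaginHeegnerData Dt β ι (s * e)),
      Literature.NumberTheory.EllipticCurves.KolyvaginDescent.KolSupp (Literature.NumberTheory.EllipticCurves.Zhang2014.IsKolyvaginPrime (W.conductorNorm ℤ) W K 2) (s * e) →
      s ≠ 1 → s.primeFactors.card ≤ 1 → 1 ≤ M → M + 1 ≤ I → (((M + 1 : ℕ) : ℕ) : ℕ∞) ≤ Literature.NumberTheory.EllipticCurves.Zhang2014.levelIndex W 2 (s * e) →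
      (∀ p ∈ (e).primeFactors, I ≤ Literature.NumberTheory.EllipticCurves.Zhang2014.kolyvaginIndex W 2 p ∧ (∃ (pl : HeightOneSpectrum (𝓞 ℚ)) (𝔓 : Ideal (absIntegers (𝓞 ℚ) ℚ)) (h : absoluteGaloisGroup ℚ), (p : 𝓞 ℚ) ∈ pl.asIdeal ∧ 𝔓 ∈ pl.primesAbove ∧ IsArithFrobAt (𝓞 ℚ) h 𝔓 ∧ (∀ X : geomTorsion W ((2 ^ M : ℕ) : ℤ), h • h • X = X) ∧ ∃ P : geomTorsion W ((2 ^ M : ℕ) : ℤ), (2 : ℤ) ^ (M - 1) • (P + h • P) ≠ 0)) →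
      (∃ (g : Fin 0 → galH1Torsion (W.baseChange K) ((2 ^ M : ℕ) : ℤ)),
        (∀ i, g i ∈ Jetchev2008.modifiedSelmerGroup W K ι ((2 ^ M : ℕ) : ℤ) e) ∧
        (∀ i, conjAct W τ ((2 ^ M : ℕ) : ℤ) (g i) = (-u) • g i) ∧
        (∀ b : Fin 0 → ℤ, (∀ σ ∈ torsionFixing (W.baseChange K) ((2 ^ (M + 1) : ℕ) : ℤ),
            h1Eval (W.baseChange K) ((2 ^ M : ℕ) : ℤ) (∑ i, b i • g i) σ = 0) → ∀ i, (2 : ℤ) ^ (M - a) ∣ b i) ∧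
        (∀ y : galH1Torsion (W.baseChange K) ((2 ^ M : ℕ) : ℤ), y ∈ Jetchev2008.modifiedSelmerGroup W K ι ((2 ^ M : ℕ) : ℤ) e →
          conjAct W τ ((2 ^ M : ℕ) : ℤ) y = (-u) • y →
          ∃ b : Fin 0 → ℤ, ∀ σ ∈ torsionFixing (W.baseChange K) ((2 ^ (M + 1) : ℕ) : ℤ),
            h1Eval (W.baseChange K) ((2 ^ M : ℕ) : ℤ) (((2 : ℤ) ^ a) • y - ∑ i, b i • g i) σ = 0)) →
      conjAct W τ ((2 ^ M : ℕ) : ℤ) (d.kolyvaginClass Nat.prime_two M) = u • d.kolyvaginClass Nat.prime_two M →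
      (∃ ρ ∈ torsionFixing (W.baseChange K) ((2 ^ M : ℕ) : ℤ),
          ((2 ^ (κ₀ a) : ℕ) : ℤ) • h1Eval (W.baseChange K) ((2 ^ M : ℕ) : ℤ) (d.kolyvaginClass Nat.prime_two M) ρ ≠ 0) →
      False := by
  intro W _ _ hCM hred hsurj K _ _ hK _ hH hodd hd3 htors hH2 Dt β ι _ hβ τ hτ u hu
  obtain ⟨C₁, hosr⟩ := KolyvaginLowerBoundAtTwo.oppositeSignReciprocityAtTwo_of_frobeniusCongruence h37 W hCM hred hsurj K hK hH
    hodd hd3 htors hH2 Dt β ι hβ τ hτ u hu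
  obtain ⟨C₂, hsrs⟩ := signedRefillSupplyAtTwo W hCM hred hsurj K hK hH hodd hd3 htors hH2 Dt β ι hβ τ hτ u hu
  refine ⟨fun a ↦ a + C₁ + C₂ + 6, fun a I M s e d hKol hs1 hcard hM hMI hidx hdeep hshape hsign hvis ↦ ?_⟩
  obtain ⟨ρ, hρ, hvisρ⟩ := hvis
  -- the class is (globally) non-zero beyond `2^{κ₀ a}`
  have hcne : ((2 ^ (a + C₁ + C₂ + 6) : ℕ) : ℤ) • d.kolyvaginClass Nat.prime_two M ≠ 0 := by
    intro h0
    apply hvisρ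
    rw [← h1Eval_zsmul _ _ _ _ hρ, h0, h1Eval_zero _ _ hρ]
  -- hence the level is large
  have hMbig : a + C₂ + 3 < M := by
    by_contra hle
    push Not at hle
    exact hcne (KolyvaginLowerBoundAtTwo.two_pow_zsmul_eq_zero_of_le_swap (by omega) (zsmul_galH1Torsion_eq_zero _ _ _))
  -- the seed part is a single prime
  have hn0 : s * e ≠ 0 := hKol.1.ne_zero
  have hs0 : s ≠ 0 := left_ne_zero_of_mul hn0
  have hsqs : Squarefree s := hKol.1.squarefree_of_dvd (dvd_mul_right s e)
  have hcard1 : s.primeFactors.card = 1 := by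
    have hne : s.primeFactors.Nonempty := by
      rw [Finset.nonempty_iff_ne_empty]
      intro h
      rcases Nat.primeFactors_eq_empty.mp h with h' | h'
      · exact hs0 h'
      · exact hs1 h'
    have hpos := Finset.card_pos.mpr hne
    omega
  obtain ⟨q, hq⟩ := Finset.card_eq_one.mp hcard1
  have hqmem : q ∈ s.primeFactors := by rw [hq]; exact Finset.mem_singleton_self q
  have hsq : s = q := by
    have h := Nat.prod_primeFactors_of_squarefree hsqs
    rw [hq, Finset.prod_singleton] at h
    exact h.symm
  have hsprime : s.Prime := by rw [hsq]; exact Nat.prime_of_mem_primeFactors hqmem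
  have hse : ¬ s ∣ e := fun h ↦ hs1 (Nat.isUnit_iff.mp (hKol.1 s (Nat.mul_dvd_mul_left s h)))
  -- SRS: the forced opposite-sign partner in `H_{𝓕(se)}`
  obtain ⟨z, hzmem, hzsign, hzne⟩ := hsrs a M s e hKol hsprime hse hM hidx hshape (by omega)
  -- the tree's pair Čebotarev window: a deep Kolyvagin prime `ℓ ∤ se` keeping both global orders up to two bits
  have h2d : ¬ (2 : ℤ) ∣ NumberField.discr K := fun h ↦ (Int.not_even_iff_odd.mpr hodd) (even_iff_two_dvd.mpr h)
  have hu' : (-u = 1 ∨ -u = -1) := by rcases hu with rfl | rfl <;> norm_num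
  obtain ⟨ℓ, hℓS, hKolℓ, hIℓ, v, hv, hcloc, hzloc⟩ :=
    KolyvaginLowerBoundAtTwo.exists_kolyvaginPrime_notMem_pair_of_heegner W K hsurj hK h2d hH hτ hM (Nat.le_succ M)
      (d.kolyvaginClass Nat.prime_two M) z hu hu' hsign hzsign (s * e).primeFactors
  have hℓn : ¬ ℓ ∣ s * e := fun h ↦ hℓS (Nat.mem_primeFactors.mpr ⟨hKolℓ.1, h, hn0⟩)
  have hzloc' : ((2 ^ (M - (a + C₂) - 3) : ℕ) : ℤ) • z ∉ (W.baseChange K).torsionLocalKer (v.adicCompletion K) ((2 ^ M : ℕ) : ℤ) := by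
    refine hzloc (M - (a + C₂) - 3) ?_
    have h3 : M - (a + C₂) - 3 + 2 = M - (a + C₂) - 1 := by omega
    rw [h3]
    exact hzne
  have hcloc' : ((2 ^ (a + C₁ + C₂ + 4) : ℕ) : ℤ) • d.kolyvaginClass Nat.prime_two M ∉
      (W.baseChange K).torsionLocalKer (v.adicCompletion K) ((2 ^ M : ℕ) : ℤ) := by
    refine hcloc (a + C₁ + C₂ + 4) ?_
    have h6 : a + C₁ + C₂ + 4 + 2 = a + C₁ + C₂ + 6 := by omega
    rw [h6]
    exact hcne
  -- a compatible datum at `se·ℓ` (Gross's CM facts, PROVED in Literature)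
  have hCM1 : phi_heegnerPointOfConductor_mem_range_map_ringClassField (W.conductorNorm ℤ) W K :=
    phi_heegnerPointOfConductor_mem_range_map_ringClassField_holds (W.conductorNorm ℤ) W K
  have hne4 : NumberField.discr K ≠ -4 := fun h ↦ by rw [h] at hodd; exact absurd hodd (by decide)
  have hD : NumberField.discr K < -4 := X11b.KolyvaginAssembly.discr_lt_neg_four hK ⟨hd3, hne4⟩
  obtain ⟨dℓ, hdℓ⟩ := Summit.BirchSwinnertonDyer.Rank1Residual.JET.exists_compatible_data_of_grossCM hCM1 hK hD hH 2 Dt β ι hKol.1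
    (fun l hl ↦ hKol.2 l hl) d
  obtain ⟨hσ, hS, hS', hemb⟩ := hdℓ ℓ hKolℓ hℓS
  -- OSR with `m := n = se`: a prime factor of `se / se = 1` — there is none
  obtain ⟨q', hq', -⟩ := hosr M (s * e) (s * e) ℓ (M - (a + C₂) - 3) (a + C₁ + C₂ + 4) 0 d z hKol hM hidx dvd_rfl hzmem hzsign hsign
    hKolℓ hℓn hIℓ v hv hzloc' hcloc' (by omega) (dℓ ℓ hKolℓ hℓS) hσ hS hS' hemb
  rw [Nat.div_self (Nat.pos_of_ne_zero hn0), Nat.primeFactors_one] at hq'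
  simp at hq'

end Summit.BirchSwinnertonDyer.BirchSwinnertonDyer.Theorems.KolyvaginAtTwo.RegularWalk

end
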